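import Summits.ResolutionOfSingularities.ResolutionOfSingularities.Theorems.HilbertSamuelEliminationSigmaMaxModificationsCorridor3TameValueHypersurfaceCut
import Summits.ResolutionOfSingularities.ResolutionOfSingularities.Theorems.HilbertSamuelEliminationSigmaMaxModificationsCorridor3HypersurfacePoints
import Summits.ResolutionOfSingularities.ResolutionOfSingularities.Theorems.HilbertSamuelEliminationSigmaMaxModificationsCorridor3QuadricGap
import Literature.AlgebraicGeometry.Motives.SubschemeCyclesRatComponentsProofs
import HarnessLib

/-!
# Route `HilbertSamuelElimination`, crux `SigmaMaxModificationsCorridor3`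
# (stmt-ResolutionOfSingularities-19249; child of `SigmaMaxModifications` stmt-…-18506),
# line `tame_wild`: helper **T-ψ**, part 1 — `Y` is equidimensional at the points of a tame
# Hilbert–Samuel stratum

[OURS · L1 W4.2] First half of helper T-ψ of `L/w42/CHAIN.md` v2 (interim assignment of plan-1,
2026-08-26T20:30Z: "tame `ν` ⇒ `Y(ν) = S₂ ⊔ S₃` clopen, `Y` locally of dimension `2` along `S₂`").
NOT a statement of any manuscript.

Let `Y` be locally of finite type over a field `k`, `ψ_Y(y) ≤ N`, and
`y ∈ Y(hypersurfaceHFe (N+1) m)` with `m ≥ 2` — at `N = 3` these are exactly the points of the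
strata of the tame values `hypersurfaceHF m ≠ Φ^{(3)}` of the line. By H1″/H1⁺
(`…Corridor3HypersurfaceValues`, `…Corridor3TameValueHypersurfaceCut`) and the regular
presentation of the local rings of `Y` (`exists_regular_presentation_stalk`),
`𝒪_{Y,y} ≅ R/(g)` with `R` regular local of dimension `ψ_Y(y) + 1` and `g` of order exactly `m`
(`exists_stalk_ringEquiv_of_mem_hsStratum`); such a ring is EQUIDIMENSIONAL
(`ringKrullDim_quotient_of_mem_minimalPrimes_quotient_span_singleton`: every minimal prime has
quotient of dimension `dim R - 1` — Krull's principal ideal theorem and catenarity). Reading the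
minimal primes of `𝒪_{Y,y}` as the irreducible components of `Y` through `y` (the tree's
`Literature.AlgebraicGeometry.Motives.comap_maximalIdeal_mem_minimalPrimes`,
`…ringKrullDim_quotient_comap_maximalIdeal`) and using the dimension formula on the integral
closed subscheme `cl{η}` (Stacks 0A21, the tree's
`Literature.AlgebraicGeometry.Motives.Scheme.height_add_coheight_eq_height_top`):

* `height_eq_hsPsi_add_height_of_mem_hsStratum` — **every irreducible component of `Y` through
  `y` has dimension `ψ_Y(y) + dim cl{y}`** (`height η` of its generic point `η`, in Mathlib's
  specialisation order `a ≤ b ↔ b ⤳ a`), and `height_eq_height_of_mem_hsStratum` — so all the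
  components through `y` have the same dimension.

Part 2 (`…Corridor3TameStratumSplit.lean`) turns this into the clopen split
`Y(ν) = S_{<N} ⊔ S_N` by two disjoint opens.

## Sources

* V. Cossart, U. Jannsen, S. Saito, LNM 2270 (2020): Def. 2.28, Thm. 2.3, Lemma 2.23, §2.2.
  [CossartJannsenSaito2020]
* The Stacks Project, Tags 0A21 (dimension theory of schemes locally of finite type over a
  field), 01J7 (`Spec 𝒪_{X,x} → X`). [StacksProject]
* H. Matsumura, *Commutative Ring Theory* (1986), §5 p. 31, Thm. 17.4. [Matsumura1987]
-/

set_option linter.dupNamespace false -- mandated namespace of this single-conjunct summit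

noncomputable section

open CategoryTheory AlgebraicGeometry TopologicalSpace Topology Order IsLocalRing
open Literature.RingTheory.HilbertSamuel Literature.AlgebraicGeometry.Resolution
open Summit.ResolutionOfSingularities.ResolutionOfSingularities.Theorems.SigmaMaxModificationsCorridor3.TameWild

namespace Summit.ResolutionOfSingularities.ResolutionOfSingularities.Theorems.SigmaMaxModificationsCorridor3.Helpers

universe u v

/-! ## Ring level: a hypersurface ring `R/(g)` is equidimensional -/

/-- **`R/(g)` is equidimensional of dimension `dim R - 1`** for a regular local ring `R` of
dimension `e` and `g ≠ 0`: for EVERY minimal prime `𝔭'` of `R/(g)`, `dim (R/(g))/𝔭' = e - 1`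
(its preimage `𝔭 ⊂ R` is a minimal prime over `(g)`, of height exactly `1` by Krull's principal
ideal theorem and `g ≠ 0` in the domain `R`; `dim R/𝔭 = e - 1` by the dimension formula in the
catenary local domain `R`). The `min` over the minimal primes is stub-2's
`minimalPrimesCodim_quotient_span_singleton`. [cite: Matsumura1987, §5 (p. 31), Thm. 17.4] -/
theorem ringKrullDim_quotient_of_mem_minimalPrimes_quotient_span_singleton {R : Type u}
    [CommRing R] [IsRegularLocalRing R] {e : ℕ} (he : ringKrullDim R = e) {g : R}
    (hg0 : g ≠ 0) {P' : Ideal (R ⧸ Ideal.span {g})}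
    (hP' : P' ∈ minimalPrimes (R ⧸ Ideal.span {g})) :
    ringKrullDim ((R ⧸ Ideal.span {g}) ⧸ P') = ((e - 1 : ℕ) : WithBot ℕ∞) := by
  haveI : IsDomain R := isDomain_of_isRegularLocalRing R
  -- `P = P' ∩ R` is a minimal prime over `(g)`, of height `1`
  set P : Ideal R := P'.comap (Ideal.Quotient.mk (Ideal.span {g})) with hP
  have hPmin : P ∈ (Ideal.span {g}).minimalPrimes := by
    rw [Ideal.minimalPrimes_eq_comap]
    exact ⟨P', hP', rfl⟩
  haveI hPp : P.IsPrime := hPmin.1.1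
  have hgP : g ∈ P := hPmin.1.2 (Ideal.mem_span_singleton_self g)
  have h1 : P.height = 1 := by
    refine le_antisymm
      (Ideal.height_le_one_of_isPrincipal_of_mem_minimalPrimes (Ideal.span {g}) P hPmin) ?_
    rw [Order.one_le_iff_ne_zero, Ne, Ideal.height_eq_zero_iff_eq_bot]
    intro hbot
    rw [hbot, Ideal.mem_bot] at hgP
    exact hg0 hgP
  -- dimension formula `ht 𝔪 = ht P + ht (𝔪/P)` in the catenary domain `R`
  have hcat := (isCatenaryRing_of_isRegularLocalRing R).height_eq_height_add_height_map_quotientMk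
    (IsLocalRing.le_maximalIdeal hPp.ne_top)
  haveI : Nontrivial (R ⧸ P) := Ideal.Quotient.nontrivial_iff.mpr hPp.ne_top
  haveI : IsLocalRing (R ⧸ P) := .of_surjective' (Ideal.Quotient.mk P) Ideal.Quotient.mk_surjective
  obtain ⟨d', hd'⟩ := exists_nat_cast_eq_ringKrullDim (R := R ⧸ P)
  have hmR : (maximalIdeal R).height = e := by
    have h := IsLocalRing.maximalIdeal_height_eq_ringKrullDim (R := R)
    rw [he] at h
    exact_mod_cast h
  have hmR' : (maximalIdeal (R ⧸ P)).height = d' := by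
    have h := IsLocalRing.maximalIdeal_height_eq_ringKrullDim (R := R ⧸ P)
    rw [hd'] at h
    exact_mod_cast h
  rw [IsLocalRing.map_maximalIdeal_of_surjective _ Ideal.Quotient.mk_surjective, hmR, hmR', h1]
    at hcat
  have hsum : e = 1 + d' := by exact_mod_cast hcat
  -- `(R/(g))/P' ≅ R/P`
  have hP'eq : P.map (Ideal.Quotient.mk (Ideal.span {g})) = P' :=
    Ideal.map_comap_of_surjective _ Ideal.Quotient.mk_surjective P'
  have hle : Ideal.span {g} ≤ P := (Ideal.span_singleton_le_iff_mem _).mpr hgP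
  let ε : (R ⧸ Ideal.span {g}) ⧸ P' ≃+* R ⧸ P :=
    (Ideal.quotEquivOfEq hP'eq.symm).trans (DoubleQuot.quotQuotEquivQuotOfLE hle)
  rw [ringKrullDim_eq_of_ringEquiv ε, hd', show e - 1 = d' by omega]

/-- **Equidimensionality transported along `A ≅ R/(g)`**: if a ring `A` is isomorphic to `R/(g)`
with `R` regular local of dimension `e`, `g ≠ 0`, then every minimal prime `𝔭` of `A` has
`dim A/𝔭 = e - 1`. [cite: Matsumura1987, §5 (p. 31), Thm. 17.4] -/
theorem ringKrullDim_quotient_of_mem_minimalPrimes_of_ringEquiv {A : Type v} [CommRing A]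
    {R : Type u} [CommRing R] [IsRegularLocalRing R] {e : ℕ} (he : ringKrullDim R = e) {g : R}
    (hg0 : g ≠ 0) (ε : A ≃+* R ⧸ Ideal.span {g}) {P : Ideal A}
    (hP : P ∈ minimalPrimes A) :
    ringKrullDim (A ⧸ P) = ((e - 1 : ℕ) : WithBot ℕ∞) := by
  obtain ⟨P', hP', hdim⟩ := exists_minimalPrimes_ringKrullDim_quotient_eq_of_ringEquiv ε.symm hP
  rw [← hdim]
  exact ringKrullDim_quotient_of_mem_minimalPrimes_quotient_span_singleton he hg0 hP'

/-! ## The local ring at a point of a tame stratum is a hypersurface ring -/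

/-- **Hypersurface presentation at a point of a tame stratum.** For `Y` locally of finite type
over a field, `ψ_Y(y) ≤ N`, `m ≥ 2` and `y ∈ Y(hypersurfaceHFe (N+1) m)` (at `N = 3`:
`H^3_Y(y) = hypersurfaceHF m`), there are a regular local ring `R` of dimension `ψ_Y(y) + 1` and
`g ∈ 𝔪_R^m ∖ 𝔪_R^{m+1}` with `𝒪_{Y,y} ≅ R/(g)`: the local ring is a quotient of a regular local
ring (`exists_regular_presentation_stalk`), which H1⁺ (`exists_regular_quotient_of_mem_hsStratum`)
cuts down to dimension `ψ_Y(y) + 1` modulo one equation of order `m`. [OURS · L1 W4.2] packaging of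
landed steps; NOT a statement of the manuscript.
[cite: CossartJannsenSaito2020, Def. 2.28, §2.2 (p. 27), Lemma 2.24] -/
theorem exists_stalk_ringEquiv_of_mem_hsStratum {k : Type} [Field k] {Y : Scheme.{0}}
    (f : Y ⟶ Spec (.of k)) [LocallyOfFiniteType f] {N m : ℕ} (hm : 2 ≤ m) {y : Y}
    (hψ : Scheme.hsPsi Y y ≤ N) (hy : y ∈ Scheme.hsStratum Y N (hypersurfaceHFe (N + 1) m)) :
    ∃ (R : Type) (_ : CommRing R) (_ : IsRegularLocalRing R) (g : R),
      ringKrullDim R = (Scheme.hsPsi Y y + 1 : ℕ) ∧ g ∈ maximalIdeal R ^ m ∧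
      g ∉ maximalIdeal R ^ (m + 1) ∧ Nonempty (Y.presheaf.stalk y ≃+* R ⧸ Ideal.span {g}) := by
  obtain ⟨S, _, _, φ, hφ⟩ := exists_regular_presentation_stalk f y
  obtain ⟨J, g, hJ, hreg, hdim, hker, hgm, hgm'⟩ :=
    exists_regular_quotient_of_mem_hsStratum hψ hm hy φ hφ
  haveI : IsRegularLocalRing (S ⧸ J) := hreg
  refine ⟨S ⧸ J, inferInstance, hreg, Ideal.Quotient.mk J g, hdim, ?_, ?_, ⟨?_⟩⟩
  · -- `ḡ ∈ 𝔪^m`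
    rw [← IsLocalRing.map_maximalIdeal_of_surjective _ Ideal.Quotient.mk_surjective,
      ← Ideal.map_pow]
    exact Ideal.mem_map_of_mem _ hgm
  · -- `ḡ ∉ 𝔪^{m+1}`: otherwise `g ∈ 𝔪^{m+1} + J`
    intro h
    rw [← IsLocalRing.map_maximalIdeal_of_surjective _ Ideal.Quotient.mk_surjective,
      ← Ideal.map_pow, Ideal.mem_map_iff_of_surjective _ Ideal.Quotient.mk_surjective] at h
    obtain ⟨g', hg', hgg'⟩ := h
    rw [Ideal.Quotient.eq] at hgg'
    have : g = g' - (g' - g) := by ring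
    exact hgm' (this ▸ Ideal.sub_mem _ (Ideal.mem_sup_left hg')
      (Ideal.mem_sup_right (Ideal.mk_ker (I := J) ▸ hgg')))
  · -- `𝒪_{Y,y} ≅ S / ker φ = S/(J + (g)) ≅ (S/J)/(ḡ)`
    refine (RingHom.quotientKerEquivOfSurjective hφ).symm.trans
      ((Ideal.quotEquivOfEq hker).trans ?_)
    refine (DoubleQuot.quotQuotEquivQuotSup J (Ideal.span {g})).symm.trans
      (Ideal.quotEquivOfEq ?_)
    rw [Ideal.map_span, Set.image_singleton]

/-! ## Pointwise: the components through a point of a tame stratum all have the same dimension -/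

/-- **Every irreducible component through a point of a tame stratum has dimension
`ψ_Y(y) + dim cl{y}`.** For `Y` locally of finite type over a field, `ψ_Y(y) ≤ N`, `m ≥ 2`,
`y ∈ Y(hypersurfaceHFe (N+1) m)`, and `η ⤳ y` maximal in the specialisation order (the generic
point of an irreducible component `Z = cl{η} ∋ y`): `height η = ψ_Y(y) + height y`, i.e.
`dim Z = ψ_Y(y) + dim cl{y}`. Proof: `𝔭_η ⊂ 𝒪_{Y,y}` is a minimal prime, `𝒪_{Y,y}/𝔭_η = 𝒪_{Z,y}`
has dimension `ψ_Y(y)` (equidimensionality of the hypersurface ring `𝒪_{Y,y} ≅ R/(g)`), and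
`dim cl{y} + dim 𝒪_{Z,y} = dim Z` on the integral scheme `Z`, locally of finite type over `k`
(Stacks 0A21). [OURS · L1 W4.2] helper T-ψ; NOT a statement of the manuscript.
[cite: StacksProject, Tag 0A21] [cite: CossartJannsenSaito2020, Def. 2.28] -/
theorem height_eq_hsPsi_add_height_of_mem_hsStratum {k : Type} [Field k] {Y : Scheme.{0}}
    (f : Y ⟶ Spec (.of k)) [LocallyOfFiniteType f] {N m : ℕ} (hm : 2 ≤ m) {y : Y}
    (hψ : Scheme.hsPsi Y y ≤ N) (hy : y ∈ Scheme.hsStratum Y N (hypersurfaceHFe (N + 1) m))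
    {η : Y} (h : η ⤳ y) (hη : IsMax η) :
    height η = (Scheme.hsPsi Y y : ℕ∞) + height y := by
  obtain ⟨R, _, _, g, hdim, hgm, hgm', ⟨ε⟩⟩ := exists_stalk_ringEquiv_of_mem_hsStratum f hm hψ hy
  have hg0 : g ≠ 0 := fun h0 => hgm' (h0 ▸ zero_mem _)
  -- `𝔭_η` is a minimal prime of `𝒪_{Y,y}` with quotient of dimension `ψ_Y(y)`
  set P : Ideal (Y.presheaf.stalk y) :=
    (maximalIdeal (Y.presheaf.stalk η)).comap (Y.presheaf.stalkSpecializes h).hom with hP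
  have hPmin : P ∈ minimalPrimes (Y.presheaf.stalk y) :=
    Literature.AlgebraicGeometry.Motives.comap_maximalIdeal_mem_minimalPrimes h hη
  have hdimP : ringKrullDim (Y.presheaf.stalk y ⧸ P) = (Scheme.hsPsi Y y : WithBot ℕ∞) := by
    rw [ringKrullDim_quotient_of_mem_minimalPrimes_of_ringEquiv hdim hg0 ε hPmin,
      Nat.add_sub_cancel]
  -- `𝒪_{Y,y}/𝔭_η = 𝒪_{Z,y}`, `Z = cl{η}` with its reduced (integral) structure
  have hcoh : coheight (Literature.AlgebraicGeometry.Motives.ClosedSubvariety.ofPointPt η h) =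
      (Scheme.hsPsi Y y : ℕ∞) := by
    have h1 := Literature.AlgebraicGeometry.Motives.ringKrullDim_quotient_comap_maximalIdeal h
    rw [← hP, hdimP] at h1
    exact_mod_cast h1.symm
  -- dimension formula on the integral scheme `Z`, locally of finite type over `k`
  let Z := Literature.AlgebraicGeometry.Motives.ClosedSubvariety.ofPoint Y η
  have h2 := Literature.AlgebraicGeometry.Motives.Scheme.height_add_coheight_eq_height_top
    (Z.ι ≫ f) (Literature.AlgebraicGeometry.Motives.ClosedSubvariety.ofPointPt η h)
  have h3 : height (⊤ : Z.carrier) = height η := by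
    rw [← Literature.AlgebraicGeometry.Motives.ClosedSubvariety.dim_eq_height_top,
      Literature.AlgebraicGeometry.Motives.ClosedSubvariety.dim_ofPoint]
  have h4 : height (Literature.AlgebraicGeometry.Motives.ClosedSubvariety.ofPointPt η h) =
      height y := by
    rw [← Z.height_ι_base]
    rfl
  rw [hcoh, h3, h4, add_comm] at h2
  exact h2.symm

/-- **All irreducible components through a point of a tame stratum have the same dimension**
(the two generic points `η, η'` of components through `y ∈ Y(hypersurfaceHFe (N+1) m)` have equal
heights). [OURS · L1 W4.2] helper T-ψ; NOT a statement of the manuscript.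
[cite: StacksProject, Tag 0A21] [cite: CossartJannsenSaito2020, Def. 2.28] -/
theorem height_eq_height_of_mem_hsStratum {k : Type} [Field k] {Y : Scheme.{0}}
    (f : Y ⟶ Spec (.of k)) [LocallyOfFiniteType f] {N m : ℕ} (hm : 2 ≤ m) {y : Y}
    (hψ : Scheme.hsPsi Y y ≤ N) (hy : y ∈ Scheme.hsStratum Y N (hypersurfaceHFe (N + 1) m))
    {η η' : Y} (h : η ⤳ y) (hη : IsMax η) (h' : η' ⤳ y) (hη' : IsMax η') :
    height η = height η' := by
  rw [height_eq_hsPsi_add_height_of_mem_hsStratum f hm hψ hy h hη,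
    height_eq_hsPsi_add_height_of_mem_hsStratum f hm hψ hy h' hη']

/-! ## Maximal points (generic points of irreducible components) -/

/-- Every point of a scheme specialises from a point maximal in the specialisation order (the
generic point of an irreducible component through it; schemes are sober). Re-derived from
`Literature.AlgebraicGeometry.HodgeTheory.exists_isMax_specializes` to keep the Hodge-theory stack
out of the imports. [folklore] -/
theorem exists_isMax_specializes' {X : Scheme.{u}} (x : X) : ∃ η : X, IsMax η ∧ η ⤳ x := by
  let K := irreducibleComponent x
  have hK : IsIrreducible K := isIrreducible_irreducibleComponent
  have hKc : IsClosed K := isClosed_irreducibleComponent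
  let η := hK.genericPoint
  have hη : IsGenericPoint η K := by
    have h := hK.isGenericPoint_genericPoint_closure
    rwa [hKc.closure_eq] at h
  refine ⟨η, fun v hv => ?_, hη.specializes mem_irreducibleComponent⟩
  have hvη : v ⤳ η := Scheme.le_iff_specializes.1 hv
  have hsub : K ⊆ closure {v} := by
    rw [← hη.def]
    exact closure_minimal (Set.singleton_subset_iff.2 hvη.mem_closure) isClosed_closure
  have heq : closure {v} = K :=
    eq_irreducibleComponent (isIrreducible_singleton.closure).isPreirreducible hsub
  have hvK : v ∈ K := heq ▸ subset_closure (Set.mem_singleton v)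
  exact Scheme.le_iff_specializes.2 (hη.specializes hvK)

/-- The height of any point is bounded by the dimension of the scheme: `height x ≤ dim X`.
[folklore] -/
theorem height_le_topologicalKrullDim {X : Scheme.{u}} (x : X) :
    ((height x : ℕ∞) : WithBot ℕ∞) ≤ topologicalKrullDim X := by
  rw [show topologicalKrullDim X = krullDim X from
    krullDim_eq_of_orderIso (irreducibleSetEquivPoints (α := X))]
  exact height_le_krullDim x

end Summit.ResolutionOfSingularities.ResolutionOfSingularities.Theorems.SigmaMaxModificationsCorridor3.Helpers

end
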